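import Summits.HodgeConjecture.HodgeConjecture.Theorems.F0P3cStCharTSRedOfEigenfunctional      -- ★ (this seat, FILE 1) «KEYS-RED ⟸ SECOND EIGENFUNCTIONAL★»: `exists_ne_bot_ne_top_of_eigenfunctional`, `exists_eigenfunctional_of_ne_bot_ne_top`; brings ★ PS-UNITARY, ★ `cmTorusCharPair`
import HarnessLib

/-!
# F0 · P3c · line LH6 «StCharTS» — RUNG 0's `hKeysRed3` ⟺ «SECOND EIGENFUNCTIONAL» (the PAIR currency dock of ★ «KEYS-RED ⟸ SECOND EIGENFUNCTIONAL★»)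
# [Keys1984 §3, §7 Thm. (1); Rogawski1990 §12.2 (3); Casselman1995 §3.2, §6.4; Bernstein–Zelevinsky 1976 Prop. 2.28, 2.25 (c)]

Cell `pub/hodgecm-mathlib`, crux H413 = `stmt-HodgeConjecture-24833` (lane `--supports … --as helper`), route HCCMUnconditional; seat F0P2-p06 (g20), DEFAULT brick FILE 2
(desk F0P3-plan (g18) WORD 2026-09-02T19:37:24Z, fences F1–F4).  THEOREMS ONLY (no definition ∕ instance ∕ notation ∕ named fact ∕ `sorry`); ★-only imports.

WHAT.  `G = Gqs L v = U(Φ₃)(L⁺_v)`, `v` NON-SPLIT (`hns`), `χ = (χ₁, χ₂)` continuous characters in RUNG 0's PAIR currency (★ `cmTorusCharPair`), `I = i_G(χ₁, χ₂)` = ★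
`cmPrincipalSeries L 3 v (cmTorusCharPair L v χ₁ χ₂)`.  RUNG 0 v8 (★ `F0P3cStCharTSRung0Eight.ellipticPackage_hyps_of_namedBlock₈`, outer binder `hKeysRed3`, :133) takes as a NAMED
INPUT Keys' reducibility theorem, case (3), ⇐-half: «for `χ₁|_{F_v^×} = 1`, `χ₁ ≠ 1` the unitary `I` is reducible (`∃ N, ⊥ ≠ N ≠ ⊤`)» [Keys1984 §7 Thm. (1) p. 126; Rogawski1990
§12.2 (3) pp. 173–174].  This file docks FILE 1 on that text TOKEN FOR TOKEN (fence F1):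
* **`keysRedThree_of_secondEigenfunctional`** — the `hKeysRed3` text VERBATIM from «SECOND EIGENFUNCTIONAL»: «for continuous `χ₁, χ₂` with `χ₁|_{F_v^×} = 1`, `χ₁ ≠ 1`, `I` carries a
  linear functional `ℓ` with `ℓ (I(p) f) = χ(proj p) · δ_B^{1/2}(p) · ℓ f` on the Borel (the `hℓ` binder of ★ K1b ∕ J2 `F0P2nFrobeniusFunctional.exists_intertwiningMap_cmPrincipalSeries_of_functional`)
  and `∀ c, ∃ f, ℓ f ≠ c · f(1)`» — print's commuting-algebra form of case (3) («`dim End_G i_G(χ) = |R| = 2`», [Keys1984 §3]; here only «`≥ 2`» is asked) — via FILE 1 §2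
  (Frobenius + admissibility + an eigenvalue on a `K`-fixed space); NO unitarity needed in this direction.  A consuming RUNG 0 edition may write
  `hKeysRed3 := keysRedThree_of_secondEigenfunctional L v hSecond` (mould of ★ `ldsRedTwo_of_keysRedThree`).
* **`secondEigenfunctional_of_keysRedThree`** (needs `hns`) — the converse via FILE 1 §3 and ★ «PS-UNITARY★» (`χ₁|_{F_v^×} = 1` is exactly the `w`-fixed condition `χ̄₁⁻¹ = χ₁`,
  and with `χ₂` on the compact `E¹_v` it makes `|χ| = 1`, so `I` is completely reducible); **`keysRedThree_iff_secondEigenfunctional`** — the re-lettering is an `Iff`, honesty-neutral.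
SCOPE (fence F3): the ALGEBRAIC half only; the ANALYTIC half — that such an `ℓ` EXISTS at the `w`-fixed unitary point (the normalised intertwining operator is non-scalar)
[Keys1984 §7 Thm. (1); Rogawski1990 §12.2 p. 173; Casselman1995 §6.4 ∕ §7.1] — stays PRINT.  (F4) no leaf ∕ junction ∕ RUNG 0 edition is touched here.
HONEST LABEL: HC_CM is proved only modulo the 7 printed citations (2 remaining named inputs: hLiu418 = `stmt-HodgeConjecture-24832`, h413 = `stmt-HodgeConjecture-24833`)
until rung 0 closes; count-neutral, honesty-neutral (an `Iff` re-lettering of a named input; Keys (3) itself stays PRINT).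

## References
* [Keys1984] D. Keys, *Principal series representations of special unitary groups over local fields*, Compositio Math. 51 (1984), §3 (commuting algebra, `R`-groups), §7 Thm. (1) p. 126.
* [Rogawski1990] J. D. Rogawski, *Automorphic Representations of Unitary Groups in Three Variables*, Ann. of Math. Stud. 123 (1990), §12.1 p. 171; §12.2 (3) pp. 173–174.
* [Casselman1995] W. Casselman, *Introduction to the theory of admissible representations of p-adic reductive groups* (1995), §3.2, §6.4.
* [BernsteinZelevinsky1976] I. N. Bernstein, A. V. Zelevinsky, Russian Math. Surveys 31:3 (1976), Prop. 2.28, 2.25 (c).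
-/

set_option autoImplicit false
-- the mandated namespace has the single-problem summit's repeated segment (`HodgeConjecture.HodgeConjecture`)
set_option linter.dupNamespace false

noncomputable section

open NumberField IsDedekindDomain
open scoped Matrix
open Literature.NumberTheory.Rogawski1990 Literature.NumberTheory.Automorphic Literature.NumberTheory.Automorphic.UnitaryGroup
open Summit.HodgeConjecture.HodgeConjecture.Cruxes.H413.F0P3cStCharTSRedOfEigenfunctional

namespace Summit.HodgeConjecture.HodgeConjecture.Cruxes.H413.F0P3cStCharTSKeysRedThreeOfEigenfunctional

/-! ## `N = 3`, `v` non-split, PAIR currency: RUNG 0's `hKeysRed3` ⟺ «SECOND EIGENFUNCTIONAL» -/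

section Pair

variable (L : Type) [Field L] [NumberField L] [IsCMField L] (v : HeightOneSpectrum (𝓞 ↥(maximalRealSubfield L)))
  (hns : ∀ w : PlacesOver L v, IsCMField.complexConj L • w.1 = w.1)

set_option synthInstance.maxHeartbeats 400000 in
set_option maxHeartbeats 8000000 in
-- statement-heavy: two ∀-closed binder texts over the `SmoothInd` carrier (class of ★ LdsRedTwoOfReducible §3)
/-- **RUNG 0's named input `hKeysRed3` (text of ★ `F0P3cStCharTSRung0Eight.ellipticPackage_hyps_of_namedBlock₈` :132, VERBATIM) FROM «SECOND EIGENFUNCTIONAL»**: Keys' reducibility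
of the unitary `i_G(χ₁, χ₂)` at `χ₁|_{F_v^×} = 1`, `χ₁ ≠ 1` [Keys1984 §7 Thm. (1); Rogawski1990 §12.2 (3)] follows from «such an `i_G(χ₁, χ₂)` carries a `(B, χ δ_B^{1/2})`-eigenfunctional
not proportional to evaluation at one» (print's commuting-algebra form: `dim End_G i_G(χ) = |R| = 2` [Keys1984 §3]) — by §2, no unitarity needed in this direction.  A consuming RUNG 0
edition may write `hKeysRed3 := keysRedThree_of_secondEigenfunctional L v hSecond`.  [cite: Keys1984, §3; §7 Thm. (1) p. 126] [cite: Rogawski1990, §12.2 (3) pp. 173–174]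
[cite: BernsteinZelevinsky1976, Proposition 2.28] -/
theorem keysRedThree_of_secondEigenfunctional
    (hSecond : haveI := locallyCompactSpace_cmBorelU L 3 v
      ∀ (χ₁ : (UnitaryGroup.LocalRing L v)ˣ →* ℂˣ) (χ₂ : ↥(normOneUnits (conjLocal L (IsCMField.complexConj L) v)) →* ℂˣ),
        Continuous (fun x => ((χ₁ x : ℂˣ) : ℂ)) → Continuous (fun x => ((χ₂ x : ℂˣ) : ℂ)) →
        (∀ a : (UnitaryGroup.LocalRing L v)ˣ, (conjLocal L (IsCMField.complexConj L) v) (a : UnitaryGroup.LocalRing L v) = a → χ₁ a = 1) → χ₁ ≠ 1 →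
        ∃ ℓ : Representation.SmoothInd (cmBorelTriple L 3 v).P
            (Representation.twist (((Representation.trivial ℂ ↥(torusU (conjLocal L (IsCMField.complexConj L) v) (cmLocalForm L 3 v)) ℂ).twist
              (UnitaryGroup.cmTorusCharPair L v χ₁ χ₂)).comp (cmBorelTriple L 3 v).proj) (rootDeltaChar (cmBorelTriple L 3 v).P)) →ₗ[ℂ] ℂ,
          (∀ (p : ↥(cmBorelTriple L 3 v).P) (f : _),
            ℓ (UnitaryGroup.cmPrincipalSeries L 3 v (UnitaryGroup.cmTorusCharPair L v χ₁ χ₂) p.1 f) =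
              ((UnitaryGroup.cmTorusCharPair L v χ₁ χ₂ ((cmBorelTriple L 3 v).proj p) : ℂˣ) : ℂ) *
                ((rootDeltaChar (cmBorelTriple L 3 v).P p : ℂˣ) : ℂ) * ℓ f) ∧
          ∀ c : ℂ, ∃ f, ℓ f ≠ c * f.toFun 1) :
    ∀ (χ₁ : (UnitaryGroup.LocalRing L v)ˣ →* ℂˣ) (χ₂ : ↥(normOneUnits (conjLocal L (IsCMField.complexConj L) v)) →* ℂˣ),
      Continuous (fun x => ((χ₁ x : ℂˣ) : ℂ)) → Continuous (fun x => ((χ₂ x : ℂˣ) : ℂ)) →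
      (∀ a : (UnitaryGroup.LocalRing L v)ˣ, (conjLocal L (IsCMField.complexConj L) v) (a : UnitaryGroup.LocalRing L v) = a → χ₁ a = 1) → χ₁ ≠ 1 →
      ∃ N : Subrepresentation (UnitaryGroup.cmPrincipalSeries L 3 v (UnitaryGroup.cmTorusCharPair L v χ₁ χ₂)), N ≠ ⊥ ∧ N ≠ ⊤ := by
  haveI := locallyCompactSpace_cmBorelU L 3 v
  intro χ₁ χ₂ h1 h2 htriv hne
  obtain ⟨ℓ, hℓ, hind⟩ := hSecond χ₁ χ₂ h1 h2 htriv hne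
  exact exists_ne_bot_ne_top_of_eigenfunctional L 3 v (cmTorusCharPair L v χ₁ χ₂) ℓ hℓ hind

include hns in
set_option synthInstance.maxHeartbeats 400000 in
set_option maxHeartbeats 8000000 in
-- statement-heavy: two ∀-closed binder texts over the `SmoothInd` carrier (class of ★ LdsRedTwoOfReducible §3)
/-- **The converse at a non-split `v`** (★ «PS-UNITARY★»: `i_G(χ₁, χ₂)` with `χ₁|_{F_v^×} = 1` is completely reducible): RUNG 0's `hKeysRed3` gives the second eigenfunctional (§3).
[cite: Keys1984, §3; §7 Thm. (1) p. 126] [cite: Rogawski1990, §12.2 (3) pp. 173–174] [cite: BernsteinZelevinsky1976, 2.25 (c); Proposition 2.28] -/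
theorem secondEigenfunctional_of_keysRedThree
    (hKeysRed3 : ∀ (χ₁ : (UnitaryGroup.LocalRing L v)ˣ →* ℂˣ) (χ₂ : ↥(normOneUnits (conjLocal L (IsCMField.complexConj L) v)) →* ℂˣ),
      Continuous (fun x => ((χ₁ x : ℂˣ) : ℂ)) → Continuous (fun x => ((χ₂ x : ℂˣ) : ℂ)) →
      (∀ a : (UnitaryGroup.LocalRing L v)ˣ, (conjLocal L (IsCMField.complexConj L) v) (a : UnitaryGroup.LocalRing L v) = a → χ₁ a = 1) → χ₁ ≠ 1 →
      ∃ N : Subrepresentation (UnitaryGroup.cmPrincipalSeries L 3 v (UnitaryGroup.cmTorusCharPair L v χ₁ χ₂)), N ≠ ⊥ ∧ N ≠ ⊤) :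
    haveI := locallyCompactSpace_cmBorelU L 3 v
    ∀ (χ₁ : (UnitaryGroup.LocalRing L v)ˣ →* ℂˣ) (χ₂ : ↥(normOneUnits (conjLocal L (IsCMField.complexConj L) v)) →* ℂˣ),
      Continuous (fun x => ((χ₁ x : ℂˣ) : ℂ)) → Continuous (fun x => ((χ₂ x : ℂˣ) : ℂ)) →
      (∀ a : (UnitaryGroup.LocalRing L v)ˣ, (conjLocal L (IsCMField.complexConj L) v) (a : UnitaryGroup.LocalRing L v) = a → χ₁ a = 1) → χ₁ ≠ 1 →
      ∃ ℓ : Representation.SmoothInd (cmBorelTriple L 3 v).P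
          (Representation.twist (((Representation.trivial ℂ ↥(torusU (conjLocal L (IsCMField.complexConj L) v) (cmLocalForm L 3 v)) ℂ).twist
            (UnitaryGroup.cmTorusCharPair L v χ₁ χ₂)).comp (cmBorelTriple L 3 v).proj) (rootDeltaChar (cmBorelTriple L 3 v).P)) →ₗ[ℂ] ℂ,
        (∀ (p : ↥(cmBorelTriple L 3 v).P) (f : _),
          ℓ (UnitaryGroup.cmPrincipalSeries L 3 v (UnitaryGroup.cmTorusCharPair L v χ₁ χ₂) p.1 f) =
            ((UnitaryGroup.cmTorusCharPair L v χ₁ χ₂ ((cmBorelTriple L 3 v).proj p) : ℂˣ) : ℂ) *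
              ((rootDeltaChar (cmBorelTriple L 3 v).P p : ℂˣ) : ℂ) * ℓ f) ∧
        ∀ c : ℂ, ∃ f, ℓ f ≠ c * f.toFun 1 := by
  haveI := locallyCompactSpace_cmBorelU L 3 v
  intro χ₁ χ₂ h1 h2 htriv hne
  obtain ⟨N', hb, ht⟩ := hKeysRed3 χ₁ χ₂ h1 h2 htriv hne
  exact exists_eigenfunctional_of_ne_bot_ne_top L 3 v (cmTorusCharPair L v χ₁ χ₂)
    (F0P3cStCharTSPrincipalSeriesUnitary.isSemisimpleRepresentation_cmPrincipalSeries_cmTorusCharPair L v hns χ₁ χ₂ h1 h2 htriv) N' hb ht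

include hns in
set_option synthInstance.maxHeartbeats 400000 in
set_option maxHeartbeats 8000000 in
-- statement-heavy: two ∀-closed binder texts over the `SmoothInd` carrier (class of ★ LdsRedTwoOfReducible §3)
/-- **`hKeysRed3` ⟺ «SECOND EIGENFUNCTIONAL»** at a non-split `v`: the re-lettering is an `Iff`, hence honesty-neutral.
[cite: Keys1984, §3; §7 Thm. (1) p. 126] [cite: Rogawski1990, §12.2 (3) pp. 173–174] [cite: Casselman1995, §6.4] -/
theorem keysRedThree_iff_secondEigenfunctional :
    haveI := locallyCompactSpace_cmBorelU L 3 v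
    (∀ (χ₁ : (UnitaryGroup.LocalRing L v)ˣ →* ℂˣ) (χ₂ : ↥(normOneUnits (conjLocal L (IsCMField.complexConj L) v)) →* ℂˣ),
      Continuous (fun x => ((χ₁ x : ℂˣ) : ℂ)) → Continuous (fun x => ((χ₂ x : ℂˣ) : ℂ)) →
      (∀ a : (UnitaryGroup.LocalRing L v)ˣ, (conjLocal L (IsCMField.complexConj L) v) (a : UnitaryGroup.LocalRing L v) = a → χ₁ a = 1) → χ₁ ≠ 1 →
      ∃ N : Subrepresentation (UnitaryGroup.cmPrincipalSeries L 3 v (UnitaryGroup.cmTorusCharPair L v χ₁ χ₂)), N ≠ ⊥ ∧ N ≠ ⊤) ↔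
    ∀ (χ₁ : (UnitaryGroup.LocalRing L v)ˣ →* ℂˣ) (χ₂ : ↥(normOneUnits (conjLocal L (IsCMField.complexConj L) v)) →* ℂˣ),
      Continuous (fun x => ((χ₁ x : ℂˣ) : ℂ)) → Continuous (fun x => ((χ₂ x : ℂˣ) : ℂ)) →
      (∀ a : (UnitaryGroup.LocalRing L v)ˣ, (conjLocal L (IsCMField.complexConj L) v) (a : UnitaryGroup.LocalRing L v) = a → χ₁ a = 1) → χ₁ ≠ 1 →
      ∃ ℓ : Representation.SmoothInd (cmBorelTriple L 3 v).P
          (Representation.twist (((Representation.trivial ℂ ↥(torusU (conjLocal L (IsCMField.complexConj L) v) (cmLocalForm L 3 v)) ℂ).twist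
            (UnitaryGroup.cmTorusCharPair L v χ₁ χ₂)).comp (cmBorelTriple L 3 v).proj) (rootDeltaChar (cmBorelTriple L 3 v).P)) →ₗ[ℂ] ℂ,
        (∀ (p : ↥(cmBorelTriple L 3 v).P) (f : _),
          ℓ (UnitaryGroup.cmPrincipalSeries L 3 v (UnitaryGroup.cmTorusCharPair L v χ₁ χ₂) p.1 f) =
            ((UnitaryGroup.cmTorusCharPair L v χ₁ χ₂ ((cmBorelTriple L 3 v).proj p) : ℂˣ) : ℂ) *
              ((rootDeltaChar (cmBorelTriple L 3 v).P p : ℂˣ) : ℂ) * ℓ f) ∧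
        ∀ c : ℂ, ∃ f, ℓ f ≠ c * f.toFun 1 :=
  ⟨secondEigenfunctional_of_keysRedThree L v hns, keysRedThree_of_secondEigenfunctional L v⟩

end Pair

end Summit.HodgeConjecture.HodgeConjecture.Cruxes.H413.F0P3cStCharTSKeysRedThreeOfEigenfunctional

end
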